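import Summits.MatrixMultiplication.MatrixMultiplication.Theorems.AbelianSTPPCensusGW2Class

/-!
# Soundness of rule U11-GW2 (`GW2Adm`): index-2 fibred Grynkiewicz–Wang with popular-set exclusion holds for every STPP family

Cell mm-stpp (rung F-M1), theory lane (seat mm-stpp-theory, gen 16).  For an `IsSTPP` family `(A_i, B_i, C_i)` with non-empty sets in a
finite abelian group `H` of even order `M = 2k`, the subgroup counts of `X = ⋃(B_j − A_j)`, `Y = ⋃(C_k − B_k)`, `Z′ = ⋃(C_i − A_i)` in an
index-2 subgroup `K` satisfy `GW2.FormOK` (file `AbelianSTPPCensusGW2Defs`) in all three letter forms, i.e. the shape list is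
`GW2.GW2Adm M`.  Ingredients: the class-pair lemma `GW2.classOK_of_isSTPP` (`AbelianSTPPCensusGW2Class.lean`: GW26 Thm 1.8 + Kneser +
Lagrange), the STPP bookkeeping `|X| = P_AB`, `r_{X,Y}(c − a) = b_i` (`STPPRepCount.*`), bilinearity of `repCount` and the index-2 class calculus
(`FP2.*`, `AddSubgroup.add_mem_iff_of_index_two`: the two mixed class counts vanish on `K`, the two pure ones off `K`), and the structure
theorem of finite abelian groups (`AddCommGroup.equiv_directSum_zmod_of_finite'`) for the existence of an index-2 subgroup at even order.

Main statements: `GW2.sum_repCount_diffUnion` (`Σ_{w ∈ Z′} r_{X,Y}(w) = Σ a b c`), `GW2.formOK_of_isSTPP` (form B for a given index-2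
subgroup), `GW2.exists_addSubgroup_index_two` (even order), `GW2.gw2Adm_of_isSTPP`, `GW2.gw2Sound` (item format).  Standard axioms only.
WHAT THIS IS NOT: no census number and no `ω` statement — a necessary condition; its first kill is `AbelianSTPPCensusGW2Wall594.lean`.

## References
* D. J. Grynkiewicz, R. Wang, arXiv:2601.17922 (2026), Theorem 1.8 [tree: `Literature.Combinatorics.Additive.PollardFourThirds`].
* H. Cohn, R. Kleinberg, B. Szegedy, C. Umans, FOCS 2005, Def. 5.1 (`IsSTPP`).
-/

set_option linter.dupNamespace false -- `MatrixMultiplication.MatrixMultiplication` (summit = problem, D-0017)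
set_option autoImplicit false

namespace Summit.MatrixMultiplication.MatrixMultiplication.Theorems

open Finset Literature.Computability.AlgebraicComplexity Literature.Combinatorics.Additive
open scoped Pointwise

namespace GW2

section Form

variable {H : Type} [AddCommGroup H] [Fintype H] [DecidableEq H] {N : ℕ} {A B C : Fin N → Finset H}

omit [Fintype H] in
/-- `Σ_{w ∈ Z′} r_{X,Y}(w) = Σ_i a_i b_i c_i`: the `a_i c_i` points `c − a` of `C_i − A_i` carry `b_i` representations each
(`STPPRepCount.repCount_eq`). [original] -/
theorem sum_repCount_diffUnion (h : IsSTPP A B C) (hB : ∀ i, (B i).Nonempty) :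
    ∑ w ∈ diffUnion A C, repCount (diffUnion A B) (diffUnion B C) w = ∑ i, (A i).card * (B i).card * (C i).card := by
  rw [diffUnion, sum_biUnion (STPPRepCount.pairwiseDisjoint_sub_CA h hB)]
  refine sum_congr rfl fun i _ => ?_
  have hinj : Set.InjOn (fun x : H × H => x.1 - x.2) ↑(C i ×ˢ A i) := by
    rintro ⟨c, a⟩ hp ⟨c', a'⟩ hq (he : c - a = c' - a')
    simp only [coe_product, Set.mem_prod, mem_coe] at hp hq
    obtain ⟨-, h2, h3⟩ := STPPRepCount.sub_CA_inj h (hB i) hp.2 hp.1 hq.2 hq.1 he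
    rw [h2, h3]
  rw [← image_sub_product, sum_image hinj]
  rw [sum_congr rfl fun (x : H × H) (hx : x ∈ C i ×ˢ A i) =>
    show repCount (diffUnion A B) (diffUnion B C) (x.1 - x.2) = (B i).card by
      rw [mem_product] at hx; rw [STPPRepCount.repCount_eq h hx.2 hx.1]]
  rw [sum_const, card_product, smul_eq_mul]
  ring

/-- **Form B of rule U11-GW2 for an STPP family** (non-empty sets) in a finite abelian group with a subgroup `K` of index `2` and order
`k`: the counts of `X`, `Y`, `Z′` in `K` pass `FormOK` — the four class pairs by `classOK_of_isSTPP`, the budgets by the index-2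
class calculus (`r_{X,Y} = Σ` of the four class counts, the two mixed ones vanish on `K` and the two pure ones off `K`) and
`Σ_{w ∈ Z′} r_{X,Y}(w) = Σ a b c`. [original] -/
theorem formOK_of_isSTPP (h : IsSTPP A B C) (hA : ∀ i, (A i).Nonempty) (hB : ∀ i, (B i).Nonempty) (hC : ∀ i, (C i).Nonempty)
    (K : AddSubgroup H) [DecidablePred (· ∈ K)] (hidx : K.index = 2) {k : ℕ} (hKk : Nat.card K = k) :
    FormOK k (pAB (fun i => (A i).card) (fun i => (B i).card) (fun i => (C i).card))
      (pBC (fun i => (A i).card) (fun i => (B i).card) (fun i => (C i).card))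
      (pCA (fun i => (A i).card) (fun i => (B i).card) (fun i => (C i).card))
      (sV (fun i => (A i).card) (fun i => (B i).card) (fun i => (C i).card))
      (univ.sup fun i => (B i).card)
      ((diffUnion A B).filter (· ∈ K)).card ((diffUnion B C).filter (· ∈ K)).card
      ((diffUnion A C).filter (· ∈ K)).card := by
  set X := diffUnion A B; set Y := diffUnion B C; set Z := diffUnion A C
  set cap := univ.sup fun i => (B i).card
  set X₀ := X.filter (· ∈ K); set X₁ := X.filter (fun w => ¬ w ∈ K)
  set Y₀ := Y.filter (· ∈ K); set Y₁ := Y.filter (fun w => ¬ w ∈ K)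
  set Z₀ := Z.filter (· ∈ K); set Z₁ := Z.filter (fun w => ¬ w ∈ K)
  set Kf : Finset H := univ.filter (· ∈ K); set Kc : Finset H := univ.filter (fun w => ¬ w ∈ K)
  -- cardinalities
  have hXc : X.card = pAB (fun i => (A i).card) (fun i => (B i).card) (fun i => (C i).card) :=
    STPPRepCount.card_diffUnion_AB h hC
  have hYc : Y.card = pBC (fun i => (A i).card) (fun i => (B i).card) (fun i => (C i).card) :=
    STPPRepCount.card_diffUnion_BC h hA
  have hZc : Z.card = pCA (fun i => (A i).card) (fun i => (B i).card) (fun i => (C i).card) :=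
    STPPRepCount.card_diffUnion_AC h hB
  have hX01 : X₀.card + X₁.card = X.card := card_filter_add_card_filter_not _
  have hY01 : Y₀.card + Y₁.card = Y.card := card_filter_add_card_filter_not _
  have hZ01 : Z₀.card + Z₁.card = Z.card := card_filter_add_card_filter_not _
  have hKf : Kf.card = k := by
    rw [← hKk, Nat.card_eq_fintype_card, Fintype.card_subtype]
  have hH : Fintype.card H = 2 * k := by
    have h1 := K.card_mul_index
    rw [hKk, hidx, Nat.card_eq_fintype_card] at h1
    omega
  have hKc : Kc.card = k := by
    have := card_filter_add_card_filter_not (s := (univ : Finset H)) (· ∈ K)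
    rw [card_univ, hH] at this
    change Kf.card + Kc.card = 2 * k at this
    omega
  have hadd : ∀ u w : H, u + w ∈ K ↔ (u ∈ K ↔ w ∈ K) := fun u w => AddSubgroup.add_mem_iff_of_index_two hidx
  have hsub : ∀ u w : H, w - u ∈ K ↔ (w ∈ K ↔ u ∈ K) := fun u w => by
    rw [sub_eq_add_neg, hadd, K.neg_mem_iff]
  have hstabf : ∀ g s : H, s ∈ Kf → g + s ∈ Kf → g ∈ K := fun g s hs hgs => by
    simp only [Kf, mem_filter, mem_univ, true_and] at hs hgs
    exact ((hadd g s).mp hgs).mpr hs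
  have hstabc : ∀ g s : H, s ∈ Kc → g + s ∈ Kc → g ∈ K := fun g s hs hgs => by
    simp only [Kc, mem_filter, mem_univ, true_and] at hs hgs
    by_contra hg
    exact hgs ((hadd g s).mpr (iff_of_false hg hs))
  have memKf : ∀ w : H, w ∈ Kf ↔ w ∈ K := fun w => by simp [Kf]
  have memKc : ∀ w : H, w ∈ Kc ↔ ¬ w ∈ K := fun w => by simp [Kc]
  -- the representation count decomposes into the four class counts
  have hdec : ∀ w, repCount X Y w = repCount X₀ Y₀ w + repCount X₀ Y₁ w + (repCount X₁ Y₀ w + repCount X₁ Y₁ w) := by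
    intro w
    rw [← FP2.repCount_union_right X₀ (disjoint_filter_filter_not Y Y (· ∈ K)) w,
      ← FP2.repCount_union_right X₁ (disjoint_filter_filter_not Y Y (· ∈ K)) w,
      ← FP2.repCount_union_left _ (disjoint_filter_filter_not X X (· ∈ K)) w,
      filter_union_filter_not_eq, filter_union_filter_not_eq]
  have v01 : ∀ w, w ∈ K → repCount X₀ Y₁ w = 0 := fun w hw => FP2.repCount_eq_zero fun u hu v hv he => by
    rw [mem_filter] at hu hv; rw [← he, hadd] at hw; exact hv.2 (hw.mp hu.2)
  have v10 : ∀ w, w ∈ K → repCount X₁ Y₀ w = 0 := fun w hw => FP2.repCount_eq_zero fun u hu v hv he => by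
    rw [mem_filter] at hu hv; rw [← he, hadd] at hw; exact hu.2 (hw.mpr hv.2)
  have v00 : ∀ w, ¬ w ∈ K → repCount X₀ Y₀ w = 0 := fun w hw => FP2.repCount_eq_zero fun u hu v hv he => by
    rw [mem_filter] at hu hv; rw [← he, hadd] at hw; exact hw (iff_of_true hu.2 hv.2)
  have v11 : ∀ w, ¬ w ∈ K → repCount X₁ Y₁ w = 0 := fun w hw => FP2.repCount_eq_zero fun u hu v hv he => by
    rw [mem_filter] at hu hv; rw [← he, hadd] at hw; exact hw (iff_of_false hu.2 hv.2)
  -- the value of `r_{X,Y}` on `Z′` is some `b_i ≤ cap`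
  have hrZ : ∀ w ∈ Z, repCount X Y w ≤ cap := by
    intro w hw
    simp only [Z, diffUnion, mem_biUnion, mem_univ, true_and] at hw
    obtain ⟨i, hi⟩ := hw
    obtain ⟨c, hc, a, ha, rfl⟩ := mem_sub.mp hi
    rw [STPPRepCount.repCount_eq h ha hc]
    exact le_sup (f := fun i => (B i).card) (mem_univ i)
  have hsum0 : ∑ w ∈ Z₀, repCount X Y w = ∑ w ∈ Z₀, repCount X₀ Y₀ w + ∑ w ∈ Z₀, repCount X₁ Y₁ w := by
    rw [← sum_add_distrib]
    refine sum_congr rfl fun w hw => ?_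
    have hwK : w ∈ K := (mem_filter.mp hw).2
    rw [hdec w, v01 w hwK, v10 w hwK]; ring
  have hsum1 : ∑ w ∈ Z₁, repCount X Y w = ∑ w ∈ Z₁, repCount X₀ Y₁ w + ∑ w ∈ Z₁, repCount X₁ Y₀ w := by
    rw [← sum_add_distrib]
    refine sum_congr rfl fun w hw => ?_
    have hwK : ¬ w ∈ K := (mem_filter.mp hw).2
    rw [hdec w, v00 w hwK, v11 w hwK]; ring
  have hbud0 : ∑ w ∈ Z₀, repCount X Y w ≤ cap * Z₀.card := by
    have := sum_le_card_nsmul Z₀ (fun w => repCount X Y w) cap (fun w hw => hrZ w (mem_filter.mp hw).1)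
    rw [smul_eq_mul, mul_comm] at this; exact this
  have hbud1 : ∑ w ∈ Z₁, repCount X Y w ≤ cap * Z₁.card := by
    have := sum_le_card_nsmul Z₁ (fun w => repCount X Y w) cap (fun w hw => hrZ w (mem_filter.mp hw).1)
    rw [smul_eq_mul, mul_comm] at this; exact this
  have htot : ∑ w ∈ Z₀, repCount X Y w + ∑ w ∈ Z₁, repCount X Y w =
      sV (fun i => (A i).card) (fun i => (B i).card) (fun i => (C i).card) := by
    rw [sum_filter_add_sum_filter_not, sum_repCount_diffUnion h hB]; rfl
  -- the four classes
  have c00 := classOK_of_isSTPP h K hKk (U := X₀) (V := Y₀) (T := Z₀) (CT := Kf) (CV := Kf)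
    (filter_subset _ _) (filter_subset _ _) (filter_subset _ _) hKf hKf
    (fun w hw => (memKf w).mpr (mem_filter.mp hw).2)
    (fun s hs => by
      obtain ⟨u, hu, v, hv, rfl⟩ := mem_add.mp hs
      exact (memKf _).mpr ((hadd u v).mpr (iff_of_true (mem_filter.mp hu).2 (mem_filter.mp hv).2)))
    (fun v hv => (memKf v).mpr (mem_filter.mp hv).2)
    (fun w hw u hu => (memKf _).mpr ((hsub u w).mpr (iff_of_true (mem_filter.mp hw).2 (mem_filter.mp hu).2)))
    hstabf
  have c11 := classOK_of_isSTPP h K hKk (U := X₁) (V := Y₁) (T := Z₀) (CT := Kf) (CV := Kc)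
    (filter_subset _ _) (filter_subset _ _) (filter_subset _ _) hKf hKc
    (fun w hw => (memKf w).mpr (mem_filter.mp hw).2)
    (fun s hs => by
      obtain ⟨u, hu, v, hv, rfl⟩ := mem_add.mp hs
      exact (memKf _).mpr ((hadd u v).mpr (iff_of_false (mem_filter.mp hu).2 (mem_filter.mp hv).2)))
    (fun v hv => (memKc v).mpr (mem_filter.mp hv).2)
    (fun w hw u hu => (memKc _).mpr fun hK => (mem_filter.mp hu).2 (((hsub u w).mp hK).mp (mem_filter.mp hw).2))
    hstabf
  have c01 := classOK_of_isSTPP h K hKk (U := X₀) (V := Y₁) (T := Z₁) (CT := Kc) (CV := Kc)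
    (filter_subset _ _) (filter_subset _ _) (filter_subset _ _) hKc hKc
    (fun w hw => (memKc w).mpr (mem_filter.mp hw).2)
    (fun s hs => by
      obtain ⟨u, hu, v, hv, rfl⟩ := mem_add.mp hs
      exact (memKc _).mpr fun hK => (mem_filter.mp hv).2 (((hadd u v).mp hK).mp (mem_filter.mp hu).2))
    (fun v hv => (memKc v).mpr (mem_filter.mp hv).2)
    (fun w hw u hu => (memKc _).mpr fun hK => (mem_filter.mp hw).2 (((hsub u w).mp hK).mpr (mem_filter.mp hu).2))
    hstabc
  have c10 := classOK_of_isSTPP h K hKk (U := X₁) (V := Y₀) (T := Z₁) (CT := Kc) (CV := Kf)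
    (filter_subset _ _) (filter_subset _ _) (filter_subset _ _) hKc hKf
    (fun w hw => (memKc w).mpr (mem_filter.mp hw).2)
    (fun s hs => by
      obtain ⟨u, hu, v, hv, rfl⟩ := mem_add.mp hs
      exact (memKc _).mpr fun hK => (mem_filter.mp hu).2 (((hadd u v).mp hK).mpr (mem_filter.mp hv).2))
    (fun v hv => (memKf v).mpr (mem_filter.mp hv).2)
    (fun w hw u hu => (memKf _).mpr (by
      rw [hsub]; exact iff_of_false (mem_filter.mp hw).2 (mem_filter.mp hu).2))
    hstabc
  -- sizes of the complements
  have eX : pAB (fun i => (A i).card) (fun i => (B i).card) (fun i => (C i).card) - X₀.card = X₁.card := by omega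
  have eY : pBC (fun i => (A i).card) (fun i => (B i).card) (fun i => (C i).card) - Y₀.card = Y₁.card := by omega
  have eZ : pCA (fun i => (A i).card) (fun i => (B i).card) (fun i => (C i).card) - Z₀.card = Z₁.card := by omega
  have hX0K : X₀.card ≤ k := hKf ▸ card_le_card fun w hw => (memKf w).mpr (mem_filter.mp hw).2
  have hY0K : Y₀.card ≤ k := hKf ▸ card_le_card fun w hw => (memKf w).mpr (mem_filter.mp hw).2
  have hZ0K : Z₀.card ≤ k := hKf ▸ card_le_card fun w hw => (memKf w).mpr (mem_filter.mp hw).2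
  have hX1K : X₁.card ≤ k := hKc ▸ card_le_card fun w hw => (memKc w).mpr (mem_filter.mp hw).2
  have hY1K : Y₁.card ≤ k := hKc ▸ card_le_card fun w hw => (memKc w).mpr (mem_filter.mp hw).2
  have hZ1K : Z₁.card ≤ k := hKc ▸ card_le_card fun w hw => (memKc w).mpr (mem_filter.mp hw).2
  refine ⟨by rw [← hXc]; exact card_filter_le _ _, by rw [← hYc]; exact card_filter_le _ _,
    by rw [← hZc]; exact card_filter_le _ _, hX0K, eX ▸ hX1K, hY0K, eY ▸ hY1K, hZ0K, eZ ▸ hZ1K,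
    ∑ w ∈ Z₀, repCount X₀ Y₀ w, ∑ w ∈ Z₀, repCount X₁ Y₁ w, ∑ w ∈ Z₁, repCount X₀ Y₁ w, ∑ w ∈ Z₁, repCount X₁ Y₀ w,
    ?_, ?_, ?_, c00, ?_, ?_, ?_⟩
  · rw [← hsum0]; exact hbud0
  · rw [← hsum1, eZ]; exact hbud1
  · rw [← htot, hsum0, hsum1]; ring
  · rw [eX, eY]; exact c11
  · rw [eY, eZ]; exact c01
  · rw [eX, eZ]; exact c10

end Form

section IndexTwo

/-- `sV` is invariant under the letter rotation `(a, b, c) ↦ (c, a, b)`. [bookkeeping] -/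
theorem sV_rotate {N : ℕ} (a b c : Fin N → ℕ) : sV c a b = sV a b c :=
  sum_congr rfl fun i _ => by ring

/-- **A finite abelian group of even order has a subgroup of index `2`.**  By the structure theorem
(`AddCommGroup.equiv_directSum_zmod_of_finite'`) `G ≅ ⨁ ℤ/nᵢ` with `∏ nᵢ = |G|` even, so some `nᵢ` is even and
`G → ℤ/nᵢ → ℤ/2` is a surjective homomorphism; its kernel has index `2`. [folklore] -/
theorem exists_addSubgroup_index_two {G : Type} [AddCommGroup G] [Finite G] (heven : Even (Nat.card G)) :
    ∃ K : AddSubgroup G, K.index = 2 := by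
  classical
  obtain ⟨ι, _, n, hn, ⟨e⟩⟩ := AddCommGroup.equiv_directSum_zmod_of_finite' G
  have hcard : Nat.card G = ∏ i, n i := by
    rw [Nat.card_congr (e.toEquiv.trans DFinsupp.equivFunOnFintype), Nat.card_pi]
    exact Finset.prod_congr rfl fun i _ => Nat.card_zmod (n i)
  have h2 : (2 : ℕ) ∣ ∏ i, n i := hcard ▸ even_iff_two_dvd.mp heven
  obtain ⟨i₀, -, hi₀⟩ := (Prime.dvd_finsetProd_iff Nat.prime_two.prime _).mp h2
  let π : (DirectSum ι fun i => ZMod (n i)) →+ ZMod (n i₀) :=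
    { toFun := fun x => x i₀
      map_zero' := DirectSum.zero_apply _ i₀
      map_add' := fun x y => DirectSum.add_apply x y i₀ }
  let φ : G →+ ZMod 2 := (ZMod.castHom hi₀ (ZMod 2)).toAddMonoidHom.comp (π.comp e.toAddMonoidHom)
  have hφ : Function.Surjective φ := by
    intro y
    obtain ⟨y', hy'⟩ := ZMod.ringHom_surjective (ZMod.castHom hi₀ (ZMod 2)) y
    refine ⟨e.symm (DirectSum.of (fun i => ZMod (n i)) i₀ y'), ?_⟩
    show ZMod.castHom hi₀ (ZMod 2) ((e (e.symm (DirectSum.of (fun i => ZMod (n i)) i₀ y'))) i₀) = y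
    rw [AddEquiv.apply_symm_apply, DirectSum.of_eq_same]
    exact hy'
  refine ⟨φ.ker, ?_⟩
  rw [AddSubgroup.index_ker, AddMonoidHom.range_eq_top.mpr hφ, AddSubgroup.card_top, Nat.card_zmod]

end IndexTwo

section Sound

variable {H : Type} [AddCommGroup H] [Fintype H] [DecidableEq H] {N : ℕ} {A B C : Fin N → Finset H}

/-- **Soundness of rule U11-GW2**: the shape data of every `IsSTPP` family with non-empty sets in a finite abelian group of order `M` is
`GW2Adm M` (at `M = 2k`: an index-2 subgroup `K` exists (`exists_addSubgroup_index_two`) and has order `k`; form B is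
`formOK_of_isSTPP`, forms A and C are form B of the rotated families `(C, A, B)`, `(B, C, A)` (`IsSTPP.rotate`), negation identifying
the classes of `⋃(A − C)` / `⋃(C − A)` etc. (`FP2.card_filter_diffUnion_swap`)). [original] -/
theorem gw2Adm_of_isSTPP (h : IsSTPP A B C) (hne : ∀ i, (A i).Nonempty ∧ (B i).Nonempty ∧ (C i).Nonempty) :
    GW2Adm (Fintype.card H) (fun i => (A i).card) (fun i => (B i).card) (fun i => (C i).card) := by
  intro k hM
  classical
  have hA : ∀ i, (A i).Nonempty := fun i => (hne i).1
  have hB : ∀ i, (B i).Nonempty := fun i => (hne i).2.1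
  have hC : ∀ i, (C i).Nonempty := fun i => (hne i).2.2
  have heven : Even (Nat.card H) := ⟨k, by rw [Nat.card_eq_fintype_card, hM]; ring⟩
  obtain ⟨K, hidx⟩ := exists_addSubgroup_index_two heven
  have hKk : Nat.card K = k := by
    have h1 := K.card_mul_index
    rw [hidx, Nat.card_eq_fintype_card (α := H), hM] at h1
    omega
  refine ⟨_, _, _, formOK_of_isSTPP h hA hB hC K hidx hKk, ?_, ?_⟩
  · have h' := formOK_of_isSTPP h.rotate.rotate hC hA hB K hidx hKk
    rw [FP2.card_filter_diffUnion_swap K A C, FP2.card_filter_diffUnion_swap K B C, sV_rotate] at h'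
    exact h'
  · have h' := formOK_of_isSTPP h.rotate hB hC hA K hidx hKk
    rw [FP2.card_filter_diffUnion_swap K A C, FP2.card_filter_diffUnion_swap K A B, sV_rotate, sV_rotate] at h'
    exact h'

/-- **`GW2Sound`** — rule U11-GW2 in the census's item format (as `u11GPrimeSound`, `fp2Sound`): every STPP family with non-empty sets in a
finite abelian group `H` satisfies `GW2Adm |H|` at its shape list.  Standard axioms; no named fact. [original] -/
theorem gw2Sound : ∀ (H : Type) [AddCommGroup H] [Fintype H] (N : ℕ) (A B C : Fin N → Finset H), IsSTPP A B C →
    (∀ i, (A i).Nonempty ∧ (B i).Nonempty ∧ (C i).Nonempty) →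
      GW2Adm (Fintype.card H) (fun i => (A i).card) (fun i => (B i).card) (fun i => (C i).card) := by
  intro H _ _ N A B C h hne
  classical
  exact gw2Adm_of_isSTPP h hne

end Sound

end GW2

end Summit.MatrixMultiplication.MatrixMultiplication.Theorems
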